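import Literature.AlgebraicGeometry.Motives.Varieties
import Mathlib.RingTheory.Ideal.KrullsHeightTheorem
import Mathlib.Algebra.MvPolynomial.Division
import Mathlib.RingTheory.Polynomial.Basic
import HarnessLib

/-!
# Discharged fact: `ℙⁿ_k` has a point of codimension one (`1 ≤ n`)

`Literature.AlgebraicGeometry.Motives.Varieties` records as a named fact
(`Literature.exists_coheight_eq_one_projectiveSpace n k : Prop`) that for `1 ≤ n` the projective
space `ℙⁿ_k = Proj k[x₀, …, xₙ]` has a point `x` with `Order.coheight x = 1`. Here the order on
the points of a scheme is Mathlib's specialization preorder (`AlgebraicGeometry.Scheme`: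
`a ≤ b ↔ b ⤳ a`, the generic point on top), so `coheight x = 1` says precisely that `x` is a
point of codimension one, i.e. the generic point of a prime divisor. This file proves the fact
(`Literature.AlgebraicGeometry.Motives.exists_coheight_eq_one_projectiveSpace_holds`); the witness is the generic point of the
hyperplane `H : x₀ = 0` of Hartshorne, *Algebraic Geometry*, II Prop. 6.4.

## Proof

* Under `↥(Proj 𝒜) = ProjectiveSpectrum 𝒜` (definitional), the specialization order of
  `Proj 𝒜` is reverse inclusion of the relevant homogeneous prime ideals
  (`Literature.AlgebraicGeometry.Motives.Proj.le_iff_asHomogeneousIdeal_le`, from Mathlib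
  `ProjectiveSpectrum.le_iff_mem_closure`).
* `x = (x₀) ⊂ S = k[x₀, …, xₙ]` is a homogeneous prime (`MvPolynomial.X_prime`) not containing
  the irrelevant ideal (`x₁ ∉ (x₀)`, using `1 ≤ n`); the generic point `η = (0)` lies strictly
  above it, so `coheight x ≥ 1`.
* If `y > x`, i.e. `𝔭_y ⊊ (x₀)`, then `height 𝔭_y < height (x₀) = 1` (Krull's
  Hauptidealsatz, Mathlib `Ideal.height_span_singleton_eq_one_of_mem_nonZeroDivisors`, and
  `Ideal.height_strict_mono_of_isPrime_of_isPrime`), so `𝔭_y = 0` and `y = η` is the top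
  element; hence `coheight x ≤ 1` (`Order.coheight_le_coe_iff`). This is Hartshorne's remark
  (proof of II.6.4) that an irreducible hypersurface of `ℙⁿ` corresponds to a homogeneous prime
  of height one in `S` (I Thm 1.11A, Prop. 1.13).

## References

* R. Hartshorne, *Algebraic Geometry*, GTM 52, Springer (1977), doi:10.1007/978-1-4757-3849-0:
  II.6, p. 130 (prime divisors and their generic points) and Prop. 6.4, p. 132 (the hyperplane
  `H = {x₀ = 0}` in `ℙⁿ_k`; "a homogeneous prime ideal of height 1 in `S`"); I Thm 1.11A and
  Prop. 1.13, p. 7. [Hartshorne1977]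
-/

noncomputable section

open CategoryTheory AlgebraicGeometry

namespace Literature.AlgebraicGeometry.Motives

universe u

section ProjOrder

variable {A σ : Type*} [CommRing A] [SetLike σ A] [AddSubgroupClass σ A]
  (𝒜 : ℕ → σ) [GradedRing 𝒜]

/-- The specialization order on the points of `Proj 𝒜` (Mathlib's default preorder on a
scheme, `a ≤ b ↔ b ⤳ a`) is reverse inclusion of the corresponding relevant homogeneous prime
ideals: `a ≤ b ↔ 𝔭_b ⊆ 𝔭_a` (Hartshorne, *Algebraic Geometry*, II.2, proof of Prop. 2.5: the
closed sets of `Proj S` are the `V(𝔞)`). [folklore] -/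
theorem Proj.le_iff_asHomogeneousIdeal_le {a b : ↥(Proj 𝒜)} :
    a ≤ b ↔ ProjectiveSpectrum.asHomogeneousIdeal (𝒜 := 𝒜) b ≤
      ProjectiveSpectrum.asHomogeneousIdeal (𝒜 := 𝒜) a :=
  (Scheme.le_iff_specializes.trans specializes_iff_mem_closure).trans
    (ProjectiveSpectrum.le_iff_mem_closure (𝒜 := 𝒜) b a).symm

end ProjOrder

section ProjectiveSpace

open MvPolynomial in
/-- Discharge of the named fact `Literature.AlgebraicGeometry.Motives.exists_coheight_eq_one_projectiveSpace`: for `1 ≤ n`,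
`ℙⁿ_k` has a point of codimension one, namely the generic point of the hyperplane
`H = {x₀ = 0}`, whose homogeneous prime ideal `(x₀) ⊂ k[x₀, …, xₙ]` has height one
(Hartshorne, *Algebraic Geometry*, II.6, p. 130 and Prop. 6.4, p. 132; I Thm 1.11A).
[cite: Hartshorne1977, II Prop. 6.4 (p. 132) with II.6 p. 130 and I Thm 1.11A] -/
theorem exists_coheight_eq_one_projectiveSpace_holds (n : ℕ) (k : Type u) [Field k] :
    exists_coheight_eq_one_projectiveSpace (n := n) (k := k) := by
  intro hn
  -- `(projectiveSpace n k).left = Proj (homogeneousSubmodule (Fin (n + 1)) k)` definitionally,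
  -- for the grading `MvPolynomial.gradedAlgebra` (which Mathlib does not register globally)
  letI := MvPolynomial.gradedAlgebra (σ := Fin (n + 1)) (R := k)
  have h01 : (0 : Fin (n + 1)) ≠ 1 := by
    rw [Ne, Fin.ext_iff, Fin.val_zero, Fin.val_one', Nat.one_mod_eq_one.mpr (by omega)]
    exact Nat.zero_ne_one
  have hXmem : ∀ i, (X i : MvPolynomial (Fin (n + 1)) k) ∈ homogeneousSubmodule (Fin (n + 1)) k 1 :=
    fun i => (mem_homogeneousSubmodule _ _).mpr (isHomogeneous_X k i)
  have hXirr : ∀ i, (X i : MvPolynomial (Fin (n + 1)) k) ∈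
      HomogeneousIdeal.irrelevant (homogeneousSubmodule (Fin (n + 1)) k) := fun i =>
    HomogeneousIdeal.mem_irrelevant_of_mem _ zero_lt_one (hXmem i)
  -- the homogeneous prime `(x₀)` of height one
  set P : Ideal (MvPolynomial (Fin (n + 1)) k) := Ideal.span {X 0}
  haveI hPprime : P.IsPrime := (Ideal.span_singleton_prime (X_ne_zero 0)).mpr X_prime
  have hPheight : P.height = 1 :=
    Ideal.height_span_singleton_eq_one_of_mem_nonZeroDivisors
      (mem_nonZeroDivisors_of_ne_zero (X_ne_zero 0)) X_prime.not_unit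
  let Ph : HomogeneousIdeal (homogeneousSubmodule (Fin (n + 1)) k) :=
    ⟨P, Ideal.homogeneous_span _ _ fun f hf => ⟨1, by
      rw [Set.mem_singleton_iff.mp hf]; exact hXmem 0⟩⟩
  -- the generic point `x` of the hyperplane `x₀ = 0` and the generic point `η` of `ℙⁿ`
  let x : ProjectiveSpectrum (homogeneousSubmodule (Fin (n + 1)) k) := ⟨Ph, hPprime, fun h =>
    h01 (X_dvd_X.mp (Ideal.mem_span_singleton.mp (h (hXirr 1))))⟩
  let η : ProjectiveSpectrum (homogeneousSubmodule (Fin (n + 1)) k) :=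
    ⟨⊥, by rw [HomogeneousIdeal.toIdeal_bot]; exact Ideal.isPrime_bot,
      fun h => X_ne_zero (0 : Fin (n + 1)) <| by
        have h0 := HomogeneousIdeal.mem_iff.mpr (h (hXirr 0))
        rwa [HomogeneousIdeal.toIdeal_bot, Ideal.mem_bot] at h0⟩
  -- the specialization order of `ℙⁿ_k` is reverse inclusion of homogeneous primes
  have hle : ∀ a b : ↥(projectiveSpace n k).left, a ≤ b ↔
      ProjectiveSpectrum.asHomogeneousIdeal (𝒜 := homogeneousSubmodule (Fin (n + 1)) k) b ≤
        ProjectiveSpectrum.asHomogeneousIdeal (𝒜 := homogeneousSubmodule (Fin (n + 1)) k) a :=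
    fun a b => Proj.le_iff_asHomogeneousIdeal_le _
  refine ⟨x, le_antisymm ?_ ?_⟩
  · -- `coheight x ≤ 1`: every `y > x` is the generic point, which is maximal
    rw [← Nat.cast_one, Order.coheight_le_coe_iff]
    intro y hy
    rw [Nat.cast_one, Order.lt_one_iff, Order.coheight_eq_zero]
    obtain ⟨hxy, hyx⟩ := lt_iff_le_not_ge.mp hy
    rw [hle] at hxy hyx
    have hlt : (ProjectiveSpectrum.asHomogeneousIdeal
        (𝒜 := homogeneousSubmodule (Fin (n + 1)) k) y).toIdeal < P :=
      lt_of_le_of_ne hxy fun h => hyx (le_of_eq (HomogeneousIdeal.ext h).symm)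
    have hbot : (ProjectiveSpectrum.asHomogeneousIdeal
        (𝒜 := homogeneousSubmodule (Fin (n + 1)) k) y).toIdeal = ⊥ := by
      have := Ideal.height_strict_mono_of_isPrime_of_isPrime hlt
      rwa [hPheight, Order.lt_one_iff, Ideal.height_eq_zero_iff_eq_bot] at this
    intro z _
    rw [hle]
    intro f hf
    have hf' : f ∈ (ProjectiveSpectrum.asHomogeneousIdeal
        (𝒜 := homogeneousSubmodule (Fin (n + 1)) k) y).toIdeal := hf
    rw [hbot, Ideal.mem_bot] at hf'
    rw [hf']
    exact zero_mem _
  · -- `1 ≤ coheight x`: the generic point `η` lies strictly above `x`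
    refine Order.one_le_iff_ne_zero.mpr (Order.coheight_ne_zero.mpr
      (not_isMax_iff.mpr ⟨η, lt_iff_le_not_ge.mpr ⟨?_, fun h => ?_⟩⟩))
    · exact (hle _ _).mpr bot_le
    · have hX0 : (X 0 : MvPolynomial (Fin (n + 1)) k) ∈ (ProjectiveSpectrum.asHomogeneousIdeal
          (𝒜 := homogeneousSubmodule (Fin (n + 1)) k) η).toIdeal :=
        (hle _ _).mp h (Ideal.mem_span_singleton_self _)
      change (X 0 : MvPolynomial (Fin (n + 1)) k) ∈
        (⊥ : HomogeneousIdeal (homogeneousSubmodule (Fin (n + 1)) k)).toIdeal at hX0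
      rw [HomogeneousIdeal.toIdeal_bot, Ideal.mem_bot] at hX0
      exact X_ne_zero _ hX0

end ProjectiveSpace

end Literature.AlgebraicGeometry.Motives
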